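import Summits.ValiantsHypothesis.ValiantsHypothesis.Theorems.PolyaContinuedMonotoneCoverHardOneLevel

/-!
# Crux `MonotoneCoverHard` (stmt-ValiantsHypothesis-7421), width line — **at least `n²/2` ACTIVE ROWS**
in every label-bijective Pfaffian cover of `per_n`

Quantitative form of `…PermanentTokens.lean` (val-width-7421-p3 g0).  A row of a cover `(m, E, a)` of
`per_n` is ACTIVE if it carries a variable-labelled edge in SOME weight-nonzero perfect matching.
`sq_le_two_mul_card_activeRows`: if `E` is Pfaffian (route's symbolic form) then
`n² ≤ 2 · #{active rows}`.  So the `n` tokens of the matchings must sweep through at least `n²/2`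
distinct rows (the known floor `m ≳ n²/2` for Pfaffian covers, localised to the active rows; tokens
confined to `n` rows — `…PermanentTokens.lean` — or to fewer than `n²/2` rows are impossible).

Proof.  Pólya signing ⇒ `per_n = det M` (`det_signedLabel_eq_perPoly`); inactive rows of `M` are
CONSTANT; after permuting columns by a weight-nonzero `τ₀` their diagonal block is unimodular
(`det_idleBlock_eq_prod`); one constant-pivot Schur step (`det_eq_C_mul_det_schur`,
`totalDegree_schur_le`) gives `per_n = c · det L` with `L` affine-linear of size `#{active rows}`, an
affine determinantal representation; Mignon–Ressayre (`sq_le_two_mul_of_hasDetRepr_perPoly`) bounds its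
size.  The column version holds by the symmetry of the permanent (not typed).  VP ≠ VNP is not moved;
`MonotoneCoverHard` stays open.  No definitions.
-/

namespace Summit.ValiantsHypothesis.ValiantsHypothesis.Theorems.PolyaContinuedMonotoneCoverHard

-- summit = sub-problem name (single-conjunct summit, D-0017 layout), so the namespace repeats it
set_option linter.dupNamespace false

open scoped Classical
open Finset
open Literature.Combinatorics.SimpleGraph (IsPolyaSigning)
open Literature.Computability.AlgebraicComplexity (HasDetRepr sq_le_two_mul_of_hasDetRepr_perPoly)
open Summit.ValiantsHypothesis.ValiantsHypothesis.Theorems.PolyaContinued.MonotoneCoverHardRectangle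
  (exists_labels aeval_permanent_cover perPoly_eq_sum_monomial label_bijection pexp_injective)

/-- **At least `n²/2` active rows.**  In a label-bijective Pfaffian cover of `per_n`, the rows
carrying a variable edge in some weight-nonzero perfect matching number at least `n²/2`. -/
theorem sq_le_two_mul_card_activeRows (n m : ℕ) (E : Finset (Fin m × Fin m))
    (a : Fin m × Fin m → MvPolynomial (Fin n × Fin n) ℂ)
    (hsig : ∃ s : Fin m × Fin m → ℂ, (∀ e, s e = 1 ∨ s e = -1) ∧
      (Matrix.of fun i j => if (i, j) ∈ E then MvPolynomial.C (s (i, j)) * MvPolynomial.X (i, j)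
          else 0 : Matrix (Fin m) (Fin m) (MvPolynomial (Fin m × Fin m) ℂ)).det =
        (Matrix.of fun i j => if (i, j) ∈ E then MvPolynomial.X (i, j) else 0 :
          Matrix (Fin m) (Fin m) (MvPolynomial (Fin m × Fin m) ℂ)).permanent)
    (ha : ∀ e, (∃ j, a e = MvPolynomial.X j) ∨ a e = 0 ∨ a e = 1)
    (hper : Literature.Computability.AlgebraicComplexity.perPoly (Fin n) ℂ =
      MvPolynomial.aeval a (Matrix.of fun i j => if (i, j) ∈ E then MvPolynomial.X (i, j) else 0 :
          Matrix (Fin m) (Fin m) (MvPolynomial (Fin m × Fin m) ℂ)).permanent) :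
    n ^ 2 ≤ 2 * (univ.filter fun i : Fin m => ∃ τ : Equiv.Perm (Fin m),
      (∀ k, (k, τ k) ∈ E ∧ a (k, τ k) ≠ 0) ∧ ∃ k, a (i, τ i) = MvPolynomial.X k).card := by
  -- Pólya signing, signed label matrix, `det M = per`
  obtain ⟨s, hs⟩ := exists_polyaSigning_of_symbolic E hsig
  obtain ⟨M, hM⟩ : ∃ M : Matrix (Fin m) (Fin m) (MvPolynomial (Fin n × Fin n) ℂ),
      ∀ i j, M i j = if ∃ τ : Equiv.Perm (Fin m), (∀ k, (k, τ k) ∈ E ∧ a (k, τ k) ≠ 0) ∧ τ i = j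
        then MvPolynomial.C ((s (i, j) : ℤ) : ℂ) * a (i, j) else 0 :=
    ⟨fun i j => if ∃ τ : Equiv.Perm (Fin m), (∀ k, (k, τ k) ∈ E ∧ a (k, τ k) ≠ 0) ∧ τ i = j
        then MvPolynomial.C ((s (i, j) : ℤ) : ℂ) * a (i, j) else 0, fun _ _ => rfl⟩
  have hdetM := det_signedLabel_eq_perPoly E a hper s hs M hM
  -- a weight-nonzero perfect matching `τ₀`
  obtain ⟨τ₀, hτ₀⟩ : ∃ τ₀ : Equiv.Perm (Fin m), ∀ i, (i, τ₀ i) ∈ E ∧ a (i, τ₀ i) ≠ 0 := by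
    obtain ⟨δ, hδ, -, -⟩ := exists_labels a ha
    set G := univ.filter fun τ : Equiv.Perm (Fin m) => ∀ i, (i, τ i) ∈ E ∧ a (i, τ i) ≠ 0 with hG
    have hsum : ∑ τ ∈ G, MvPolynomial.monomial (∑ i, δ (i, τ i)) (1 : ℂ) =
        ∑ σ : Equiv.Perm (Fin n),
          MvPolynomial.monomial (∑ k, Finsupp.single (k, σ k) 1) (1 : ℂ) := by
      rw [← aeval_permanent_cover E a δ hδ G hG, ← hper, perPoly_eq_sum_monomial]
    obtain ⟨-, -, hsurj⟩ := label_bijection G (fun τ => ∑ i, δ (i, τ i))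
      (fun σ : Equiv.Perm (Fin n) => ∑ k, Finsupp.single (k, σ k) (1 : ℕ)) pexp_injective hsum
    obtain ⟨τ, hτG, -⟩ := hsurj 1
    rw [hG] at hτG
    exact ⟨τ, (mem_filter.1 hτG).2⟩
  -- used edges of an inactive row are not variable
  have hK1 : ∀ i j, (∃ τ : Equiv.Perm (Fin m), (∀ k, (k, τ k) ∈ E ∧ a (k, τ k) ≠ 0) ∧ τ i = j) →
      ((i, j) ∈ E ∧ a (i, j) ≠ 0) ∧
      ((¬ ∃ τ : Equiv.Perm (Fin m), (∀ k, (k, τ k) ∈ E ∧ a (k, τ k) ≠ 0) ∧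
          ∃ k, a (i, τ i) = MvPolynomial.X k) → ¬ ∃ k, a (i, j) = MvPolynomial.X k) := by
    rintro i j ⟨τ, hτ, rfl⟩
    exact ⟨hτ i, fun hna hv => hna ⟨τ, hτ, hv⟩⟩
  have hK2 : ∀ e, a e ≠ 0 → (¬ ∃ k, a e = MvPolynomial.X k) → a e = 1 := by
    intro e h1 h2
    rcases ha e with h | h | h
    · exact absurd h h2
    · exact absurd h h1
    · exact h
  have hunit : ∀ e, ((s e : ℤ) : ℂ) ≠ 0 := fun e => by
    rcases Int.units_eq_one_or (s e) with h | h <;> simp [h]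
  -- the column-permuted matrix `M₁ = M ∘ τ₀` and its constant companion `Sf`
  set M₁ : Matrix (Fin m) (Fin m) (MvPolynomial (Fin n × Fin n) ℂ) :=
    M.submatrix id τ₀ with hM₁def
  have hM₁ : ∀ i i', M₁ i i' =
      if ∃ τ : Equiv.Perm (Fin m), (∀ k, (k, τ k) ∈ E ∧ a (k, τ k) ≠ 0) ∧ τ i = τ₀ i'
      then MvPolynomial.C ((s (i, τ₀ i') : ℤ) : ℂ) * a (i, τ₀ i') else 0 := fun i i' => by
    rw [hM₁def, Matrix.submatrix_apply]
    exact hM i (τ₀ i')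
  have hdet₁ : M₁.det = ((Equiv.Perm.sign τ₀ : ℤ) : MvPolynomial (Fin n × Fin n) ℂ) *
      M.det := Matrix.det_permute' τ₀ M
  obtain ⟨Sf, hSf⟩ : ∃ Sf : Matrix (Fin m) (Fin m) ℂ, ∀ i i', Sf i i' =
      if ∃ τ : Equiv.Perm (Fin m), (∀ k, (k, τ k) ∈ E ∧ a (k, τ k) ≠ 0) ∧ τ i = τ₀ i'
      then ((s (i, τ₀ i') : ℤ) : ℂ) else 0 :=
    ⟨fun i i' => if ∃ τ : Equiv.Perm (Fin m), (∀ k, (k, τ k) ∈ E ∧ a (k, τ k) ≠ 0) ∧ τ i = τ₀ i'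
      then ((s (i, τ₀ i') : ℤ) : ℂ) else 0, fun _ _ => rfl⟩
  -- inactive rows are constant
  have hZrow : ∀ i i', (¬ ∃ τ : Equiv.Perm (Fin m), (∀ k, (k, τ k) ∈ E ∧ a (k, τ k) ≠ 0) ∧
        ∃ k, a (i, τ i) = MvPolynomial.X k) →
      M₁ i i' = MvPolynomial.C (Sf i i') := by
    intro i i' hi
    rw [hM₁, hSf]
    split_ifs with hu
    · rw [hK2 _ (hK1 _ _ hu).1.2 ((hK1 _ _ hu).2 hi), mul_one]
    · exact MvPolynomial.C_0.symm
  -- all entries are affine-linear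
  have hdeg : ∀ i i', (M₁ i i').totalDegree ≤ 1 := by
    intro i i'
    rw [hM₁]
    split_ifs with hu
    · by_cases hv : ∃ k, a (i, τ₀ i') = MvPolynomial.X k
      · obtain ⟨k, hk⟩ := hv
        rw [hk]
        calc (MvPolynomial.C ((s (i, τ₀ i') : ℤ) : ℂ) * MvPolynomial.X k).totalDegree
            ≤ (MvPolynomial.C ((s (i, τ₀ i') : ℤ) : ℂ) :
                MvPolynomial (Fin n × Fin n) ℂ).totalDegree +
              (MvPolynomial.X k : MvPolynomial (Fin n × Fin n) ℂ).totalDegree :=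
              MvPolynomial.totalDegree_mul _ _
          _ ≤ 0 + 1 := Nat.add_le_add (le_of_eq (MvPolynomial.totalDegree_C _))
              (MvPolynomial.totalDegree_X k).le
          _ = 1 := rfl
      · rw [hK2 _ (hK1 _ _ hu).1.2 hv, mul_one, MvPolynomial.totalDegree_C]
        exact Nat.zero_le _
    · rw [MvPolynomial.totalDegree_zero]
      exact Nat.zero_le _
  /- Schur complement through the idle block `B × B`, `B` = inactive rows -/
  obtain ⟨p, hp⟩ : ∃ p : Fin m → Prop, ∀ i, p i ↔ ¬ ∃ τ : Equiv.Perm (Fin m),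
      (∀ k, (k, τ k) ∈ E ∧ a (k, τ k) ≠ 0) ∧ ∃ k, a (i, τ i) = MvPolynomial.X k :=
    ⟨_, fun _ => Iff.rfl⟩
  set S : Matrix {i // p i} {i // p i} ℂ := Matrix.of fun i i' => Sf i i' with hS
  have hSdet : S.det = ∏ i : {i // p i}, ((s ((i : Fin m), τ₀ i) : ℤ) : ℂ) :=
    det_idleBlock_eq_prod E a ha hper s τ₀ hτ₀ p (fun i hi hv => (hp i).1 hi ⟨τ₀, hτ₀, hv⟩)
      (fun i i' hi _ hu => (hK1 _ _ hu).2 ((hp i).1 hi)) S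
      (fun i i' => by rw [hS, Matrix.of_apply, hSf])
  have hSne : S.det ≠ 0 := by
    rw [hSdet]
    exact Finset.prod_ne_zero_iff.2 fun i _ => hunit _
  have hstep := det_eq_C_mul_det_schur M₁ p S hSne
    (fun i j => by rw [hS, Matrix.of_apply]; exact hZrow i j ((hp _).1 i.2))
  set L : Matrix {i // ¬ p i} {i // ¬ p i} (MvPolynomial (Fin n × Fin n) ℂ) :=
    Matrix.of fun (i j : {i // ¬ p i}) => M₁ i j -
      ∑ l : {i // p i}, ∑ k : {i // p i}, M₁ i k * MvPolynomial.C (S⁻¹ k l) * M₁ l j with hL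
  have hLdeg : ∀ i j, (L i j).totalDegree ≤ 1 := fun i j => by
    rw [hL, Matrix.of_apply]
    exact totalDegree_schur_le M₁ p S⁻¹ 1 0 (by norm_num) hdeg (fun i k => hdeg i k)
      (fun l j => le_of_eq (by rw [hZrow l j ((hp _).1 l.2), MvPolynomial.totalDegree_C])) i j
  /- `per = C c · det L` with `c ≠ 0` -/
  set c : ℂ := ((Equiv.Perm.sign τ₀ : ℤ) : ℂ) * S.det with hc
  have hcne : c ≠ 0 := by
    refine mul_ne_zero ?_ hSne
    rcases Int.units_eq_one_or (Equiv.Perm.sign τ₀) with h | h <;> simp [h]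
  have hsignsq : ((Equiv.Perm.sign τ₀ : ℤ) : MvPolynomial (Fin n × Fin n) ℂ) *
      ((Equiv.Perm.sign τ₀ : ℤ) : MvPolynomial (Fin n × Fin n) ℂ) = 1 := by
    rw [← Int.cast_mul, ← Units.val_mul, Int.units_mul_self, Units.val_one, Int.cast_one]
  have hperL : Literature.Computability.AlgebraicComplexity.perPoly (Fin n) ℂ =
      MvPolynomial.C c * L.det := by
    have h1 : M.det = ((Equiv.Perm.sign τ₀ : ℤ) : MvPolynomial (Fin n × Fin n) ℂ) *
        M₁.det := by
      rw [hdet₁, ← mul_assoc, hsignsq, one_mul]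
    rw [← hdetM, h1, hstep, hc, map_mul,
      ← map_intCast (MvPolynomial.C : ℂ →+* MvPolynomial (Fin n × Fin n) ℂ)]
    ring
  /- reindex the active rows by `Fin N` and scale a row: an affine representation of size `N` -/
  set N := (univ.filter fun i : Fin m => ∃ τ : Equiv.Perm (Fin m),
      (∀ k, (k, τ k) ∈ E ∧ a (k, τ k) ≠ 0) ∧ ∃ k, a (i, τ i) = MvPolynomial.X k).card with hN
  have hcardA : Fintype.card {i // ¬ p i} = N := by
    rw [Fintype.card_subtype, hN]
    congr 1
    exact Finset.filter_congr fun i _ => by rw [hp, not_not]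
  -- `N ≥ n ≥ 1` unless `n = 0`
  have hnN : n ≤ N := by
    rw [← card_var_eq E a ha hper τ₀ hτ₀, hN]
    exact Finset.card_le_card fun i hi => by
      simp only [mem_filter, mem_univ, true_and] at hi ⊢
      exact ⟨τ₀, hτ₀, hi⟩
  rcases Nat.lt_or_ge n 3 with hn3 | hn3
  · nlinarith [hnN, hn3, Nat.zero_le n]
  obtain ⟨n', rfl⟩ : ∃ k, n = k + 3 := ⟨n - 3, by omega⟩
  have hNpos : 0 < N := by omega
  have e₄ : {i // ¬ p i} ≃ Fin N := Fintype.equivFinOfCardEq hcardA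
  set F₀ : Matrix (Fin N) (Fin N) (MvPolynomial (Fin (n' + 3) × Fin (n' + 3)) ℂ) :=
    L.submatrix e₄.symm e₄.symm with hF₀
  have hF₀det : F₀.det = L.det := Matrix.det_submatrix_equiv_self e₄.symm L
  set i₀ : Fin N := ⟨0, hNpos⟩ with hi₀
  set F : Matrix (Fin N) (Fin N) (MvPolynomial (Fin (n' + 3) × Fin (n' + 3)) ℂ) :=
    F₀.updateRow i₀ ((MvPolynomial.C c : MvPolynomial (Fin (n' + 3) × Fin (n' + 3)) ℂ) • F₀ i₀)
    with hF
  have hFdet : F.det = MvPolynomial.C c * F₀.det := by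
    rw [hF, Matrix.det_updateRow_smul, Matrix.updateRow_eq_self]
  have hFdeg : ∀ i j, (F i j).totalDegree ≤ 1 := by
    intro i j
    by_cases hi : i = i₀
    · subst hi
      rw [hF, Matrix.updateRow_self, Pi.smul_apply, smul_eq_mul]
      calc (MvPolynomial.C c * F₀ i₀ j).totalDegree
          ≤ (MvPolynomial.C c : MvPolynomial (Fin (n' + 3) × Fin (n' + 3)) ℂ).totalDegree +
            (F₀ i₀ j).totalDegree := MvPolynomial.totalDegree_mul _ _
        _ ≤ 0 + 1 := Nat.add_le_add (le_of_eq (MvPolynomial.totalDegree_C _))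
            (by rw [hF₀, Matrix.submatrix_apply]; exact hLdeg _ _)
        _ = 1 := rfl
    · rw [hF, Matrix.updateRow_ne hi, hF₀, Matrix.submatrix_apply]
      exact hLdeg _ _
  have hrepr : HasDetRepr (Literature.Computability.AlgebraicComplexity.perPoly (Fin (n' + 3)) ℂ) N :=
    ⟨F, fun i j => hFdeg i j, by rw [hFdet, hF₀det, ← hperL]⟩
  exact sq_le_two_mul_of_hasDetRepr_perPoly hrepr

end Summit.ValiantsHypothesis.ValiantsHypothesis.Theorems.PolyaContinuedMonotoneCoverHard
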